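import Mathlib
import Summits.MatrixMultiplication.MatrixMultiplication.Theses.GLnSeparatingDesigns

/-!
# The split-design volume law refutes the split form of `BorderHalfDimensionDesigns`

Stub `stub_not_split_of_splitLaw` (E2 = the split-design barrier, step (iv)) of line `Ideate5Sketch`
(crux `BorderHalfDimensionDesigns`, item stmt-MatrixMultiplication-18360, route `GLnSeparatingDesigns`).

Given the split-design volume law `hlaw` — for `n ≥ 3`, `s ≥ 2`, outer sets `X ⊆ H₁`, `Z⁻¹ ⊆ H₂`
whose targets `x z⁻¹` are read `η`-approximately by polynomials of degree `≤ s` (`η·|X||Z| < 1`) and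
one middle test `p₀` of degree `≤ s`, left-`(H₁,χ₁)`- and right-`(H₂,χ₂)`-semi-invariant on `GL_n(ℂ)`
with nonsingular Gram matrix `(p₀(y⁻¹ y'))_{y,y' ∈ Y}`, one has `|X||Y||Z| ≤ s^(n(n−1)/2) C(2s+n², n²)` —
the split form of the crux fails: take `ε := 1/8`, the `n` it yields, `δ := 1/(16 n)` and
`q ≥ exp (16 n² log n + 1)`; shrink the outer sets `X`, `Z` (not `Y`, whose Gram matrix is part of the
data) to exactly `N := ⌈q^(n²/2 − n/8)⌉` elements, put `s := ⌊q^(1+δ)⌋`, `η := 1/(2(N²+1))`; the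
readers demanded by the law are the separators of the design evaluated at the quadruples
`(x, y₁, y₁, z)` for one fixed `y₁ ∈ Y` (`x y₁⁻¹ y₁ z⁻¹ = x z⁻¹`).  The law then reads, after logarithms
and `C(2s+n²,n²) ≤ (2s+n²)^(n²) ≤ (s n²)^(n²)`, `((n+1)/32) log q ≤ 2 n² log n`, contradicting the
choice of `q`.  Pure real-analysis bookkeeping, line by line as in the transfer
`stub_not_borderHalfDimensionDesigns_of_law`.
-/

set_option linter.dupNamespace false

namespace Summit.MatrixMultiplication.MatrixMultiplication.Theorems.BorderHalfDimensionDesigns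

/-- STUB (iv) of E2 — **the split law refutes the split form of the crux** (`SplitBorderHalfDimensionDesigns`
of SplitBarrierSketch.lean, inlined): a law of the shape (iii) at every `n ≥ 3`, `s ≥ 2` excludes, for
`ε = 1/8`, half-dimensional designs with a split structure — shrink `X`, `Z` to `N = ⌈q^(n²/2−n/8)⌉` elements
(so that `η := 1/(2(N²+1))` is admissible for the readers obtained from the separators at `y = y'`), keep `Y`,
`s := ⌊q^(1+δ)⌋`, `δ := 1/(16 n)`: `N²·q^(n²/2 − n/8) ≤ s^(C(n,2))·(2s+n²)^(n²)` fails for large `q`. -/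
theorem stub_not_split_of_splitLaw
    (hlaw : ∀ (n s : ℕ) (η : ℝ), 3 ≤ n → 2 ≤ s →
      ∀ (H₁ H₂ : Subgroup (Matrix.GeneralLinearGroup (Fin n) ℂ)) (χ₁ χ₂ : Matrix.GeneralLinearGroup (Fin n) ℂ → ℂ)
        (X Y Z : Finset (Matrix.GeneralLinearGroup (Fin n) ℂ)),
        (∀ x ∈ X, x ∈ H₁) → (∀ z ∈ Z, z⁻¹ ∈ H₂) →
        (∀ x₀ ∈ X, ∀ z₀ ∈ Z, ∃ r : MvPolynomial (Fin n × Fin n) ℂ, r.totalDegree ≤ s ∧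
          ∀ x ∈ X, ∀ z ∈ Z,
            ((x = x₀ ∧ z = z₀) → ‖MvPolynomial.eval (fun ij : Fin n × Fin n =>
              ((x * z⁻¹ : Matrix.GeneralLinearGroup (Fin n) ℂ) : Matrix (Fin n) (Fin n) ℂ) ij.1 ij.2) r - 1‖ ≤ η) ∧
            (¬ (x = x₀ ∧ z = z₀) → ‖MvPolynomial.eval (fun ij : Fin n × Fin n =>
              ((x * z⁻¹ : Matrix.GeneralLinearGroup (Fin n) ℂ) : Matrix (Fin n) (Fin n) ℂ) ij.1 ij.2) r‖ ≤ η)) →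
        η * (X.card * Z.card) < 1 →
        ∀ (p₀ : MvPolynomial (Fin n × Fin n) ℂ), p₀.totalDegree ≤ s →
        (∀ h ∈ H₁, ∀ w : Matrix.GeneralLinearGroup (Fin n) ℂ,
          MvPolynomial.eval (fun ij : Fin n × Fin n =>
            ((h * w : Matrix.GeneralLinearGroup (Fin n) ℂ) : Matrix (Fin n) (Fin n) ℂ) ij.1 ij.2) p₀ =
          χ₁ h * MvPolynomial.eval (fun ij : Fin n × Fin n => (w : Matrix (Fin n) (Fin n) ℂ) ij.1 ij.2) p₀) →
        (∀ h ∈ H₂, ∀ w : Matrix.GeneralLinearGroup (Fin n) ℂ,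
          MvPolynomial.eval (fun ij : Fin n × Fin n =>
            ((w * h : Matrix.GeneralLinearGroup (Fin n) ℂ) : Matrix (Fin n) (Fin n) ℂ) ij.1 ij.2) p₀ =
          χ₂ h * MvPolynomial.eval (fun ij : Fin n × Fin n => (w : Matrix (Fin n) (Fin n) ℂ) ij.1 ij.2) p₀) →
        (Matrix.of fun y y' : ↥Y => MvPolynomial.eval (fun ij : Fin n × Fin n =>
          ((y.1⁻¹ * y'.1 : Matrix.GeneralLinearGroup (Fin n) ℂ) : Matrix (Fin n) (Fin n) ℂ) ij.1 ij.2) p₀).det ≠ 0 →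
        X.card * Y.card * Z.card ≤ s ^ (n * (n - 1) / 2) * (2 * s + n ^ 2).choose (n ^ 2)) :
    ¬ (∀ ε : ℝ, 0 < ε → ∃ n : ℕ, 3 ≤ n ∧ ∀ δ : ℝ, 0 < δ → ∀ q₀ : ℕ, ∃ q : ℕ, q₀ ≤ q ∧ ∀ η : ℝ, 0 < η →
      ∃ X Y Z : Finset (Matrix.GeneralLinearGroup (Fin n) ℂ),
        (q : ℝ) ^ ((n : ℝ) ^ 2 / 2 - ε * n) ≤ (X.card : ℝ) ∧
        (q : ℝ) ^ ((n : ℝ) ^ 2 / 2 - ε * n) ≤ (Y.card : ℝ) ∧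
        (q : ℝ) ^ ((n : ℝ) ^ 2 / 2 - ε * n) ≤ (Z.card : ℝ) ∧
        (∀ x₀ ∈ X, ∀ z₀ ∈ Z, ∃ p : MvPolynomial (Fin n × Fin n) ℂ,
          (p.totalDegree : ℝ) ≤ (q : ℝ) ^ (1 + δ) ∧
          ∀ x ∈ X, ∀ y ∈ Y, ∀ y' ∈ Y, ∀ z ∈ Z,
            ((x = x₀ ∧ y = y' ∧ z = z₀) → ‖MvPolynomial.eval (fun ij : Fin n × Fin n =>
              ((x * y⁻¹ * y' * z⁻¹ : Matrix.GeneralLinearGroup (Fin n) ℂ) : Matrix (Fin n) (Fin n) ℂ) ij.1 ij.2) p - 1‖ ≤ η) ∧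
            (¬ (x = x₀ ∧ y = y' ∧ z = z₀) → ‖MvPolynomial.eval (fun ij : Fin n × Fin n =>
              ((x * y⁻¹ * y' * z⁻¹ : Matrix.GeneralLinearGroup (Fin n) ℂ) : Matrix (Fin n) (Fin n) ℂ) ij.1 ij.2) p‖ ≤ η)) ∧
        ∃ (H₁ H₂ : Subgroup (Matrix.GeneralLinearGroup (Fin n) ℂ)) (χ₁ χ₂ : Matrix.GeneralLinearGroup (Fin n) ℂ → ℂ)
          (p₀ : MvPolynomial (Fin n × Fin n) ℂ),
          (∀ x ∈ X, x ∈ H₁) ∧ (∀ z ∈ Z, z⁻¹ ∈ H₂) ∧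
          (p₀.totalDegree : ℝ) ≤ (q : ℝ) ^ (1 + δ) ∧
          (∀ h ∈ H₁, ∀ w : Matrix.GeneralLinearGroup (Fin n) ℂ,
            MvPolynomial.eval (fun ij : Fin n × Fin n =>
              ((h * w : Matrix.GeneralLinearGroup (Fin n) ℂ) : Matrix (Fin n) (Fin n) ℂ) ij.1 ij.2) p₀ =
            χ₁ h * MvPolynomial.eval (fun ij : Fin n × Fin n => (w : Matrix (Fin n) (Fin n) ℂ) ij.1 ij.2) p₀) ∧
          (∀ h ∈ H₂, ∀ w : Matrix.GeneralLinearGroup (Fin n) ℂ,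
            MvPolynomial.eval (fun ij : Fin n × Fin n =>
              ((w * h : Matrix.GeneralLinearGroup (Fin n) ℂ) : Matrix (Fin n) (Fin n) ℂ) ij.1 ij.2) p₀ =
            χ₂ h * MvPolynomial.eval (fun ij : Fin n × Fin n => (w : Matrix (Fin n) (Fin n) ℂ) ij.1 ij.2) p₀) ∧
          (Matrix.of fun y y' : ↥Y => MvPolynomial.eval (fun ij : Fin n × Fin n =>
            ((y.1⁻¹ * y'.1 : Matrix.GeneralLinearGroup (Fin n) ℂ) : Matrix (Fin n) (Fin n) ℂ) ij.1 ij.2) p₀).det ≠ 0) := by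
  intro hsplit
  -- ε := 1/8 gives n ≥ 3
  obtain ⟨n, hn3, hn⟩ := hsplit (1 / 8) (by norm_num)
  have hnpos : (0 : ℝ) < n := by exact_mod_cast (by omega : 0 < n)
  have hn0 : (n : ℝ) ≠ 0 := hnpos.ne'
  have hn3r : (3 : ℝ) ≤ n := by exact_mod_cast hn3
  have hln : 0 ≤ Real.log n := Real.log_nonneg (by linarith)
  -- δ := 1/(16 n), K := 16 n² log n, q₀ := ⌈exp (K+1)⌉₊
  obtain ⟨δ, hδdef⟩ : ∃ δ : ℝ, δ = 1 / (16 * n) := ⟨_, rfl⟩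
  have hδpos : 0 < δ := by rw [hδdef]; positivity
  obtain ⟨K, hKdef⟩ : ∃ K : ℝ, K = 16 * (n : ℝ) ^ 2 * Real.log n := ⟨_, rfl⟩
  have hKnn : 0 ≤ K := by
    have h2 : 0 ≤ (n : ℝ) ^ 2 * Real.log n := mul_nonneg (by positivity) hln
    rw [hKdef]; linarith only [h2]
  obtain ⟨q, hq₀, hq⟩ := hn δ hδpos ⌈Real.exp (K + 1)⌉₊
  have hqK : Real.exp (K + 1) ≤ q := le_trans (Nat.le_ceil _) (by exact_mod_cast hq₀)
  have hq2 : (2 : ℝ) ≤ q := by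
    have := Real.add_one_le_exp (K + 1)
    linarith
  have hqpos : (0 : ℝ) < q := by linarith
  have hq1 : (1 : ℝ) ≤ q := by linarith
  obtain ⟨L, hLdef⟩ : ∃ L : ℝ, L = Real.log q := ⟨_, rfl⟩
  have hLK : K + 1 ≤ L := by
    have := Real.log_le_log (Real.exp_pos _) hqK
    rwa [Real.log_exp, ← hLdef] at this
  have hLnn : 0 ≤ L := by linarith
  -- degree budget s := ⌊q^(1+δ)⌋₊ and outer size N := ⌈q^a⌉₊, a := n²/2 − n/8
  obtain ⟨a, hadef⟩ : ∃ a : ℝ, a = (n : ℝ) ^ 2 / 2 - 1 / 8 * n := ⟨_, rfl⟩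
  have hqδnn : (0 : ℝ) ≤ (q : ℝ) ^ (1 + δ) := Real.rpow_nonneg hqpos.le _
  have hqδ : (q : ℝ) ≤ (q : ℝ) ^ (1 + δ) := by
    have := Real.rpow_le_rpow_of_exponent_le hq1 (show (1 : ℝ) ≤ 1 + δ by linarith)
    rwa [Real.rpow_one] at this
  obtain ⟨s, hs2, hsle, hsdeg⟩ : ∃ s : ℕ, 2 ≤ s ∧ (s : ℝ) ≤ (q : ℝ) ^ (1 + δ) ∧
      ∀ d : ℕ, (d : ℝ) ≤ (q : ℝ) ^ (1 + δ) → d ≤ s :=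
    ⟨⌊(q : ℝ) ^ (1 + δ)⌋₊, Nat.le_floor (by push_cast; linarith), Nat.floor_le hqδnn,
      fun d hd => Nat.le_floor hd⟩
  have hs2r : (2 : ℝ) ≤ s := by exact_mod_cast hs2
  have hspos : (0 : ℝ) < s := by linarith
  have hqa : (0 : ℝ) < (q : ℝ) ^ a := Real.rpow_pos_of_pos hqpos a
  obtain ⟨N, hNge, hNle⟩ : ∃ N : ℕ, (q : ℝ) ^ a ≤ N ∧ ∀ m : ℕ, (q : ℝ) ^ a ≤ m → N ≤ m :=
    ⟨⌈(q : ℝ) ^ a⌉₊, Nat.le_ceil _, fun m hm => Nat.ceil_le.mpr hm⟩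
  have hNpos : (0 : ℝ) < N := lt_of_lt_of_le hqa hNge
  have hNN : (0 : ℝ) < (N : ℝ) * N := mul_pos hNpos hNpos
  -- tolerance η := 1/(2 (N² + 1)); the split design at this tolerance
  obtain ⟨η, hηdef⟩ : ∃ η : ℝ, η = 1 / (2 * ((N : ℝ) * N + 1)) := ⟨_, rfl⟩
  have hηpos : 0 < η := by rw [hηdef]; positivity
  obtain ⟨X, Y, Z, hX, hY, hZ, hsep, H₁, H₂, χ₁, χ₂, p₀, hXH, hZH, hp₀deg, hleft, hright, hGram⟩ :=
    hq η hηpos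
  rw [← hadef] at hX hY hZ
  -- shrink the outer sets `X`, `Z` to `N` elements each; keep `Y` (nonempty), fix `y₁ ∈ Y`
  obtain ⟨X', hX'X, hX'card⟩ := Finset.exists_subset_card_eq (hNle _ hX)
  obtain ⟨Z', hZ'Z, hZ'card⟩ := Finset.exists_subset_card_eq (hNle _ hZ)
  have hYpos : (0 : ℝ) < Y.card := lt_of_lt_of_le hqa hY
  obtain ⟨y₁, hy₁⟩ : Y.Nonempty := Finset.card_pos.mp (by exact_mod_cast hYpos)
  have hηN : η * ((X'.card : ℝ) * Z'.card) < 1 := by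
    rw [hX'card, hZ'card, hηdef, div_mul_eq_mul_div, one_mul, div_lt_one (by positivity)]
    linarith only [hNN]
  -- readers of the targets `x z⁻¹` on `X' × Z'`: the separators at the quadruples `(x, y₁, y₁, z)`
  have hread : ∀ x₀ ∈ X', ∀ z₀ ∈ Z', ∃ r : MvPolynomial (Fin n × Fin n) ℂ, r.totalDegree ≤ s ∧
      ∀ x ∈ X', ∀ z ∈ Z',
        ((x = x₀ ∧ z = z₀) → ‖MvPolynomial.eval (fun ij : Fin n × Fin n =>
          ((x * z⁻¹ : Matrix.GeneralLinearGroup (Fin n) ℂ) : Matrix (Fin n) (Fin n) ℂ) ij.1 ij.2) r - 1‖ ≤ η) ∧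
        (¬ (x = x₀ ∧ z = z₀) → ‖MvPolynomial.eval (fun ij : Fin n × Fin n =>
          ((x * z⁻¹ : Matrix.GeneralLinearGroup (Fin n) ℂ) : Matrix (Fin n) (Fin n) ℂ) ij.1 ij.2) r‖ ≤ η) := by
    intro x₀ hx₀ z₀ hz₀
    obtain ⟨p, hp, hsep'⟩ := hsep x₀ (hX'X hx₀) z₀ (hZ'Z hz₀)
    refine ⟨p, hsdeg _ hp, fun x hx z hz => ?_⟩
    have h := hsep' x (hX'X hx) y₁ hy₁ y₁ hy₁ z (hZ'Z hz)
    rw [inv_mul_cancel_right] at h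
    exact ⟨fun hxz => h.1 ⟨hxz.1, rfl, hxz.2⟩, fun hxz => h.2 fun h3 => hxz ⟨h3.1, h3.2.2⟩⟩
  -- the law on `(X', Y, Z')`
  have hcost := hlaw n s η hn3 hs2 H₁ H₂ χ₁ χ₂ X' Y Z' (fun x hx => hXH x (hX'X hx))
    (fun z hz => hZH z (hZ'Z hz)) hread hηN p₀ (hsdeg _ hp₀deg) hleft hright hGram
  rw [hX'card, hZ'card] at hcost
  have hNYN : (0 : ℝ) < (N : ℝ) * Y.card * N := mul_pos (mul_pos hNpos hYpos) hNpos
  have hcostR : (N : ℝ) * Y.card * N ≤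
      (s : ℝ) ^ (n * (n - 1) / 2) * ((2 * s + n ^ 2).choose (n ^ 2) : ℝ) := by
    exact_mod_cast hcost
  -- take logarithms
  have hCh : (0 : ℝ) < ((2 * s + n ^ 2).choose (n ^ 2) : ℝ) := by
    exact_mod_cast Nat.choose_pos (Nat.le_add_left _ _)
  have hSE : (0 : ℝ) < (s : ℝ) ^ (n * (n - 1) / 2) := pow_pos hspos _
  have hlog := Real.log_le_log hNYN hcostR
  rw [Real.log_mul hSE.ne' hCh.ne', Real.log_pow, Real.log_mul (mul_pos hNpos hYpos).ne' hNpos.ne',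
    Real.log_mul hNpos.ne' hYpos.ne'] at hlog
  -- the elementary estimates, M := (1+δ) log q
  obtain ⟨M, hMdef⟩ : ∃ M : ℝ, M = (1 + δ) * L := ⟨_, rfl⟩
  have hMnn : 0 ≤ M := by rw [hMdef]; exact mul_nonneg (by linarith) hLnn
  have hlogN : a * L ≤ Real.log N := by
    have := Real.log_le_log hqa hNge
    rwa [Real.log_rpow hqpos, ← hLdef] at this
  have hlogY : a * L ≤ Real.log Y.card := by
    have := Real.log_le_log hqa hY
    rwa [Real.log_rpow hqpos, ← hLdef] at this
  have hlogs : Real.log s ≤ M := by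
    have := Real.log_le_log hspos hsle
    rwa [Real.log_rpow hqpos, ← hLdef, ← hMdef] at this
  -- the exponent E := n(n-1)/2 (natural division) is at most (n² − n)/2
  have hE : 2 * ((n * (n - 1) / 2 : ℕ) : ℝ) + n ≤ (n : ℝ) * n := by
    have h' : n * (n - 1) + n = n * n := by
      rw [Nat.mul_sub_one, Nat.sub_add_cancel (Nat.le_mul_self n)]
    have h1 : 2 * (n * (n - 1) / 2) + n ≤ n * n := by
      have := Nat.mul_div_le (n * (n - 1)) 2
      omega
    exact_mod_cast h1
  have hEnn : (0 : ℝ) ≤ ((n * (n - 1) / 2 : ℕ) : ℝ) := Nat.cast_nonneg _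
  have hEle : ((n * (n - 1) / 2 : ℕ) : ℝ) ≤ ((n : ℝ) ^ 2 - n) / 2 := by
    have e : (n : ℝ) ^ 2 = n * n := by ring
    rw [e]; linarith only [hE]
  have hE1 : ((n * (n - 1) / 2 : ℕ) : ℝ) * Real.log s
      ≤ ((n * (n - 1) / 2 : ℕ) : ℝ) * M := mul_le_mul_of_nonneg_left hlogs hEnn
  have hE2 : ((n * (n - 1) / 2 : ℕ) : ℝ) * M ≤ ((n : ℝ) ^ 2 - n) / 2 * M :=
    mul_le_mul_of_nonneg_right hEle hMnn
  have hchoose : Real.log ((2 * s + n ^ 2).choose (n ^ 2) : ℝ) ≤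
      (n : ℝ) ^ 2 * (M + 2 * Real.log n) := by
    have h1 : ((2 * s + n ^ 2).choose (n ^ 2) : ℝ) ≤ (2 * (s : ℝ) + n ^ 2) ^ (n ^ 2) := by
      exact_mod_cast Nat.choose_le_pow (2 * s + n ^ 2) (n ^ 2)
    have h2 : Real.log ((2 * s + n ^ 2).choose (n ^ 2) : ℝ) ≤
        (n ^ 2 : ℕ) * Real.log (2 * (s : ℝ) + n ^ 2) := by
      rw [← Real.log_pow]; exact Real.log_le_log hCh h1
    have hn9 : (9 : ℝ) ≤ (n : ℝ) ^ 2 := by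
      have h33 : (3 : ℝ) * 3 ≤ (n : ℝ) * n := mul_le_mul hn3r hn3r (by norm_num) hnpos.le
      have e : (n : ℝ) ^ 2 = n * n := by ring
      rw [e]; linarith only [h33]
    have hA : (1 : ℝ) * 7 ≤ ((s : ℝ) - 1) * ((n : ℝ) ^ 2 - 2) :=
      mul_le_mul (by linarith only [hs2r]) (by linarith only [hn9]) (by norm_num)
        (by linarith only [hs2r])
    have h3 : 2 * (s : ℝ) + n ^ 2 ≤ s * n ^ 2 := by
      have e : ((s : ℝ) - 1) * ((n : ℝ) ^ 2 - 2) = s * n ^ 2 - 2 * s - n ^ 2 + 2 := by ring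
      rw [e] at hA; linarith only [hA]
    have hn2pos : (0 : ℝ) < (n : ℝ) ^ 2 := by positivity
    have h4 : Real.log (2 * (s : ℝ) + n ^ 2) ≤ Real.log s + 2 * Real.log n := by
      have := Real.log_le_log (by positivity) h3
      rw [Real.log_mul hspos.ne' hn2pos.ne', Real.log_pow] at this
      push_cast at this; linarith only [this]
    have h5 : Real.log (2 * (s : ℝ) + n ^ 2) ≤ M + 2 * Real.log n := by linarith only [h4, hlogs]
    have h6 : ((n ^ 2 : ℕ) : ℝ) = (n : ℝ) ^ 2 := by push_cast; ring
    rw [h6] at h2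
    exact le_trans h2 (mul_le_mul_of_nonneg_left h5 hn2pos.le)
  -- main inequality: ((n+1)/32) log q ≤ 2 n² log n
  have hid : 3 * (a * L) - (((n : ℝ) ^ 2 - n) / 2 + n ^ 2) * M = ((n : ℝ) + 1) / 32 * L := by
    rw [hMdef, hadef, hδdef]; field_simp; ring
  have key : ((n : ℝ) + 1) / 32 * L ≤ 2 * (n : ℝ) ^ 2 * Real.log n := by
    rw [← hid]; linarith only [hlog, hlogN, hlogY, hE1, hE2, hchoose]
  -- while log q ≥ K + 1, K = 16 n² log n
  have hK8 : (1 / 8 : ℝ) * L ≤ ((n : ℝ) + 1) / 32 * L :=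
    mul_le_mul_of_nonneg_right (by linarith) hLnn
  rw [hKdef] at hLK
  linarith only [key, hK8, hLK]

end Summit.MatrixMultiplication.MatrixMultiplication.Theorems.BorderHalfDimensionDesigns
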